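import Literature.Computability.Complexity.RandomizedExtensionFieldZeroTest
import Literature.Computability.MetaComplexity.GFDesignFP
import Literature.Computability.AlgebraicComplexity.PITLanguageCoRP
import Literature.Computability.Complexity.CodeFPStrings
import Literature.Computability.Complexity.PlumbingBricks
import HarnessLib

/-!
# The randomised identity test for integer circuit CODES modulo a fixed prime: an `FP` evaluator
# in `𝔽_p[X]/(f)` (ACIT over `𝔽_p` as a polynomial identity ∈ coRP — the evaluator brick)

An `FP` string function which, on `⟨w, y⟩`, reads off the coins `y` a monic modulus
`f = X^k + Σ_{j<k} c_j X^j ∈ 𝔽_p[X]` (`k` blocks of `b` coins, `ExtFieldZeroTest.modRow/modPoly`) and a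
point `a ∈ (𝔽_p[X]/(f))^V` with `{0,1}`-coefficient coordinates (`V` blocks of `k` coins,
`ExtFieldZeroTest.bitRow/ptOf`), and evaluates the integer circuit READ OFF THE ARBITRARY STRING `w`
(junk-tolerant semantics `CircuitCode.rdCircuit` of `CircuitCodeReading.lean`) at `a` IN THE RING
`𝔽_p[X]/(f)` — on canonical remainder ROWS of length `k` (the list arithmetic `GFDesign.addL`,
`smulL`, `mulmodL` of `MetaComplexity/GFDesignList.lean`, computed on codes in polynomial time by
`GFDesignFP.lean`) — answering `1` iff the remainder row of the output is zero. This is exactly the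
evaluator hypothesis of the randomised extension-field zero test
(`Complexity/RandomizedExtensionFieldZeroTest.lean`: `ExtFieldZeroTest.mem_coRP_of_extFieldZeroTest`),
the characteristic-`p` twin of `CircuitCodeModularEvaluator.lean` (evaluation modulo a random NUMBER,
Schwartz 1980 §3 / Ibarra–Moran 1983 §4); here Schwartz–Zippel is run in the extension field
`𝔽_{p^k}` realised as `𝔽_p[X]/(f)` for a random monic `f` (Agrawal–Biswas 2003, §1; Lidl–Niederreiter).
The evaluator is assembled in the typed polynomial-time calculus `CodeFP` (`Complexity/CodeFP*.lean`),
no machine being written: gate by gate (`CodeFP.foldl` over the coded gate list, accumulator = the raw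
list of the value rows, linear in the input since rows have length `k ≤ |y|` and entries are residues),
each gate a fold over its argument items.

* the program on rows: `opVal` (value of an operand code: gate reference, constant, variable = a
  row of the point, junk = `0`), `prodVal` / `sumVal` / `gateVal` (product and weighted-sum gates),
  `valsOf` (all gate rows), `evalRow` (the output row), with the CONTEXT `(V, q, pt)` (`q` = the low
  coefficients of `f`, `pt` = the point rows);
* **the semantic bridge** `cls_evalRow`: for a context with rows of length `k = |q| ≥ 1`, the class
  of `evalRow` in `𝔽_p[X]/(f)`, `f = X^k + ofList q`, is `φ (rdCircuit V w).eval`, `φ` the evaluation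
  `eval₂ (ℤ → 𝔽_p[X]/(f)) (point)` (the rows follow `ArithCircuit.gateValues`; `GFDesign.mk_ofList_mulmodL`,
  `ofList_addL`, `ofList_smulL`), and `φ_eq_aeval`: `φ P = aeval (ptOf …) (map (ℤ → 𝔽_p) P)`;
* the typed polynomial-time facts `intToZMod`, `opVal_codeFP`, `prodVal_codeFP`, `sumVal_codeFP`,
  `gateVal_codeFP`, `valsOf_codeFP`, `evalRow_codeFP`, the coin readers `modRow_codeFP`, `bitRow_codeFP`,
  `ptRows_codeFP`, and the whole answer `resultRow` /
  `acceptBit` with `acceptBit_codeFP` and `acceptBit_eq_true_iff`;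
* **`exists_extEvalF`**: for every prime `p` and polynomials `v, d` there is a ONE-BIT `E ∈ FP` with
  `E ⟨w, y⟩ = 1 ↔ aeval (ptOf …) (map (ℤ → 𝔽_p) (rdCircuit V w).eval) = 0` in `𝔽_p[X]/(modPoly p b k y)`,
  `V = v(|w|)`, `k = kOf d |w|`, `b = bOf p d |w|` — the `hspec` of `mem_coRP_of_extFieldZeroTest`
  (no hypothesis on `|y|`: the readers are total, short coin strings are read with padding).

Consumer: `PITLanguageModP.lean` (`{w | map (ℤ → 𝔽_p) (semPoly w) = 0} ∈ coRP`, identity testing of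
integer circuits modulo `p`; the characteristic-`p` half of the `∃BPP` verifier of BIJL18 Thm. 4).
HONEST FRAMING: a textbook evaluator; `VP ≠ VNP` is NOT proved and nothing here bears on it.

## References

* J. T. Schwartz, *Fast probabilistic algorithms for verification of polynomial identities*, J. ACM 27
  (1980), Lemma 1 / Cor. 1 and §3 [Schwartz1980]; O. H. Ibarra, S. Moran, J. ACM 30 (1983), §4
  [IbarraMoran1983].
* M. Agrawal, S. Biswas, *Primality and identity testing via Chinese remaindering*, J. ACM 50 (2003),
  §1 [AgrawalBiswas2003].
* V. Kabanets, R. Impagliazzo, Comput. Complexity 13 (2004), §2 (circuits as strings)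
  [KabanetsImpagliazzo2004].
* J. von zur Gathen, J. Gerhard, *Modern Computer Algebra*, 3rd ed., CUP 2013, §4.1–4.2 (arithmetic in
  `𝔽_p[X]/(P)` on coefficient vectors) [GathenGerhard1999].
* S. Arora, B. Barak, *Computational Complexity: A Modern Approach*, CUP 2009, §1.3 (closure of
  polynomial time under composition and bounded loops), Lemma 7.5 [AroraBarakCC2009].
-/

noncomputable section

namespace Literature.Computability.AlgebraicComplexity

namespace CircuitCode

namespace ExtEval

open _root_.Computability Polynomial Literature.Computability.Complexity
  Literature.Computability.Complexity.CodeFP Literature.Computability.Complexity.GaussRank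
  Literature.Computability.Complexity.Brick Literature.Computability.Complexity.ExtFieldZeroTest
  Literature.Computability.MetaComplexity ArithCircuit

variable (p : ℕ)

/-! ### The evaluation program on remainder rows -/

section Program

/-- The zero row of length `k`. [folklore] -/
def zeroRow (k : ℕ) : List (ZMod p) := List.replicate k 0

/-- The row of the constant `c`: `c · 1` (`GFDesign.oneL`). [cite: GathenGerhard1999, §4.1] -/
def constRow (k : ℕ) (c : ZMod p) : List (ZMod p) := GFDesign.smulL p c (GFDesign.oneL p k)

/-- **The row of an operand code** `u` over `V` variables, given the point rows `pt` and the gate rows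
`vals` computed so far (the row semantics of `CircuitCode.rdOp`): `1·j ↦ vals[⟦j⟧]`, `01·c ↦` the constant
`rdInt c mod p`, `00·i ↦ pt[⟦i⟧]` if `⟦i⟧ < V`, else the constant `0`; rows past the end are `0`.
[cite: KabanetsImpagliazzo2004, §2] -/
def opVal (V k : ℕ) (pt vals : List (List (ZMod p))) (u : List Bool) : List (ZMod p) :=
  if u.headD false then vals.getD (bitsToNat u.tail) (zeroRow p k)
  else if u.tail.headD false then constRow p k (rdInt u.tail.tail : ZMod p)
  else if bitsToNat u.tail.tail < V then pt.getD (bitsToNat u.tail.tail) (zeroRow p k)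
  else constRow p k 0

/-- **The row of a product gate**: the product, modulo `f = X^k + ofList q`, of the rows of its argument
items. [cite: GathenGerhard1999, §4.2 (multiplication in `𝔽_p[X]/(P)`)] -/
def prodVal (V : ℕ) (q : List (ZMod p)) (pt vals : List (List (ZMod p))) (items : List (List Bool)) :
    List (ZMod p) :=
  items.foldl (fun acc it => GFDesign.mulmodL p q acc (opVal p V q.length pt vals it)) (GFDesign.oneL p q.length)

/-- **The row of a weighted-sum gate**: `Σ (rdInt c) · row(u)` over its items `⟨c, u⟩`.
[cite: GathenGerhard1999, §4.1 (addition in `𝔽_p[X]/(P)`)] -/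
def sumVal (V : ℕ) (q : List (ZMod p)) (pt vals : List (List (ZMod p))) (items : List (List Bool)) :
    List (ZMod p) :=
  items.foldl (fun acc it => GFDesign.addL p acc
    (GFDesign.smulL p (rdInt (fstF it) : ZMod p) (opVal p V q.length pt vals (sndF it)))) (zeroRow p q.length)

/-- **The row of a gate code** (tag `1` = product, tag `0` = weighted sum of its items `rdItems`).
[cite: KabanetsImpagliazzo2004, §2] -/
def gateVal (V : ℕ) (q : List (ZMod p)) (pt vals : List (List (ZMod p))) (g : List Bool) : List (ZMod p) :=
  if g.headD false then prodVal p V q pt vals (rdItems g) else sumVal p V q pt vals (rdItems g)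

/-- **The rows of all gates**, accumulated along the coded gate list (the row form of
`ArithCircuit.gateValues`). [cite: KabanetsImpagliazzo2004, §2] -/
def valsOf (V : ℕ) (q : List (ZMod p)) (pt : List (List (ZMod p))) (gcodes : List (List Bool)) :
    List (List (ZMod p)) :=
  gcodes.foldl (fun vals g => vals ++ [gateVal p V q pt vals g]) []

/-- **The output row**: the row of the output operand of the circuit read off `w` over `V` variables,
in `𝔽_p[X]/(X^k + ofList q)` at the point `pt`. [cite: Schwartz1980, §3] -/
def evalRow (V : ℕ) (q : List (ZMod p)) (pt : List (List (ZMod p))) (w : List Bool) : List (ZMod p) :=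
  opVal p V q.length pt (valsOf p V q pt (rdGateCodes w)) (rdOutCode w)

end Program

/-! ### Lengths: every row has the length of the modulus row -/

section Lengths

variable {p}

/-- `|zeroRow k| = k`. [folklore] -/
@[simp] private theorem length_zeroRow (k : ℕ) : (zeroRow p k).length = k := by simp [zeroRow]

/-- `|constRow k c| = k`. [folklore] -/
@[simp] private theorem length_constRow (k : ℕ) (c : ZMod p) : (constRow p k c).length = k := by
  simp [constRow]

/-- An operand row has length `k` when the point rows and the gate rows do. [folklore] -/
private theorem length_opVal {V k : ℕ} {pt vals : List (List (ZMod p))} (hpt : ∀ r ∈ pt, r.length = k)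
    (hvals : ∀ r ∈ vals, r.length = k) (u : List Bool) : (opVal p V k pt vals u).length = k := by
  unfold opVal
  split_ifs with h1 h2 h3
  · rcases lt_or_ge (bitsToNat u.tail) vals.length with h | h
    · rw [List.getD_eq_getElem _ _ h]; exact hvals _ (List.getElem_mem h)
    · rw [List.getD_eq_default _ _ h, length_zeroRow]
  · exact length_constRow _ _
  · rcases lt_or_ge (bitsToNat u.tail.tail) pt.length with h | h
    · rw [List.getD_eq_getElem _ _ h]; exact hpt _ (List.getElem_mem h)
    · rw [List.getD_eq_default _ _ h, length_zeroRow]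
  · exact length_constRow _ _

/-- An operand row is never longer than `k` if no point row and no gate row is. [folklore] -/
private theorem length_opVal_le {V k : ℕ} {pt vals : List (List (ZMod p))} (hpt : ∀ r ∈ pt, r.length ≤ k)
    (hvals : ∀ r ∈ vals, r.length ≤ k) (u : List Bool) : (opVal p V k pt vals u).length ≤ k := by
  unfold opVal
  split_ifs with h1 h2 h3
  · rcases lt_or_ge (bitsToNat u.tail) vals.length with h | h
    · rw [List.getD_eq_getElem _ _ h]; exact hvals _ (List.getElem_mem h)
    · rw [List.getD_eq_default _ _ h, length_zeroRow]
  · exact (length_constRow _ _).le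
  · rcases lt_or_ge (bitsToNat u.tail.tail) pt.length with h | h
    · rw [List.getD_eq_getElem _ _ h]; exact hpt _ (List.getElem_mem h)
    · rw [List.getD_eq_default _ _ h, length_zeroRow]
  · exact (length_constRow _ _).le

/-- Along the product loop the accumulator is never longer than the modulus row. [folklore] -/
private theorem length_prodFold_le (V : ℕ) (q : List (ZMod p)) (pt vals : List (List (ZMod p))) :
    ∀ (its : List (List Bool)) (acc : List (ZMod p)), acc.length ≤ q.length →
      (its.foldl (fun acc it => GFDesign.mulmodL p q acc (opVal p V q.length pt vals it)) acc).length ≤ q.length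
  | [], acc, h => by simpa using h
  | it :: its, acc, h => by
    rw [List.foldl_cons]
    refine length_prodFold_le V q pt vals its _ ?_
    rw [GFDesign.mulmodL]
    exact (GFDesign.length_foldl_mulStep_le (p := p) q acc _ _ (by simp) (by simp)).1

/-- Along the sum loop the accumulator is never longer than at the start. [folklore] -/
private theorem length_sumFold_le (V : ℕ) (q : List (ZMod p)) (pt vals : List (List (ZMod p))) :
    ∀ (its : List (List Bool)) (acc : List (ZMod p)) (m : ℕ), acc.length ≤ m →
      (its.foldl (fun acc it => GFDesign.addL p acc
        (GFDesign.smulL p (rdInt (fstF it) : ZMod p) (opVal p V q.length pt vals (sndF it)))) acc).length ≤ m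
  | [], acc, m, h => by simpa using h
  | it :: its, acc, m, h => by
    rw [List.foldl_cons]
    refine length_sumFold_le V q pt vals its _ m ?_
    rw [GFDesign.length_addL]
    exact (min_le_left _ _).trans h

/-- A product row is never longer than the modulus row. [folklore] -/
private theorem length_prodVal_le (V : ℕ) (q : List (ZMod p)) (pt vals : List (List (ZMod p)))
    (items : List (List Bool)) : (prodVal p V q pt vals items).length ≤ q.length := by
  rw [prodVal]
  suffices h : ∀ (its : List (List Bool)) (acc : List (ZMod p)), acc.length ≤ q.length →
      (its.foldl (fun acc it => GFDesign.mulmodL p q acc (opVal p V q.length pt vals it)) acc).length ≤ q.length from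
    h items _ (by simp)
  intro its
  induction its with
  | nil => intro acc h; simpa using h
  | cons it its ih =>
    intro acc hacc
    rw [List.foldl_cons]
    refine ih _ ?_
    rw [GFDesign.mulmodL]
    exact (GFDesign.length_foldl_mulStep_le (p := p) q acc _ _ (by simp) (by simp)).1

/-- A product row has length `|q|` when the accumulated rows do. [folklore] -/
private theorem length_prodVal (V : ℕ) (q : List (ZMod p)) (pt vals : List (List (ZMod p)))
    (items : List (List Bool)) : (prodVal p V q pt vals items).length = q.length := by
  rw [prodVal]
  suffices h : ∀ (its : List (List Bool)) (acc : List (ZMod p)), acc.length = q.length →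
      (its.foldl (fun acc it => GFDesign.mulmodL p q acc (opVal p V q.length pt vals it)) acc).length = q.length from
    h items _ (by simp)
  intro its
  induction its with
  | nil => intro acc h; simpa using h
  | cons it its ih =>
    intro acc hacc
    rw [List.foldl_cons]
    exact ih _ (GFDesign.length_mulmodL p rfl hacc _)

/-- A sum row has length `≤ |q|`. [folklore] -/
private theorem length_sumVal_le (V : ℕ) (q : List (ZMod p)) (pt vals : List (List (ZMod p)))
    (items : List (List Bool)) : (sumVal p V q pt vals items).length ≤ q.length := by
  rw [sumVal]
  suffices h : ∀ (its : List (List Bool)) (acc : List (ZMod p)), acc.length ≤ q.length →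
      (its.foldl (fun acc it => GFDesign.addL p acc
        (GFDesign.smulL p (rdInt (fstF it) : ZMod p) (opVal p V q.length pt vals (sndF it)))) acc).length ≤ q.length from
    h items _ (by simp)
  intro its
  induction its with
  | nil => intro acc h; simpa using h
  | cons it its ih =>
    intro acc hacc
    rw [List.foldl_cons]
    refine ih _ ?_
    rw [GFDesign.length_addL]
    exact (min_le_left _ _).trans hacc

/-- A sum row has length `|q|` when the point rows and the accumulated rows do. [folklore] -/
private theorem length_sumVal {V : ℕ} {q : List (ZMod p)} {pt vals : List (List (ZMod p))}
    (hpt : ∀ r ∈ pt, r.length = q.length) (hvals : ∀ r ∈ vals, r.length = q.length)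
    (items : List (List Bool)) : (sumVal p V q pt vals items).length = q.length := by
  rw [sumVal]
  suffices h : ∀ (its : List (List Bool)) (acc : List (ZMod p)), acc.length = q.length →
      (its.foldl (fun acc it => GFDesign.addL p acc
        (GFDesign.smulL p (rdInt (fstF it) : ZMod p) (opVal p V q.length pt vals (sndF it)))) acc).length = q.length from
    h items _ (by simp)
  intro its
  induction its with
  | nil => intro acc h; simpa using h
  | cons it its ih =>
    intro acc hacc
    rw [List.foldl_cons]
    refine ih _ ?_
    rw [GFDesign.length_addL, GFDesign.length_smulL, length_opVal hpt hvals, hacc, min_self]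

/-- A gate row has length `≤ |q|`. [folklore] -/
private theorem length_gateVal_le (V : ℕ) (q : List (ZMod p)) (pt vals : List (List (ZMod p))) (g : List Bool) :
    (gateVal p V q pt vals g).length ≤ q.length := by
  unfold gateVal; split_ifs
  · exact length_prodVal_le _ _ _ _ _
  · exact length_sumVal_le _ _ _ _ _

/-- A gate row has length `|q|` when the point rows and the earlier rows do. [folklore] -/
private theorem length_gateVal {V : ℕ} {q : List (ZMod p)} {pt vals : List (List (ZMod p))}
    (hpt : ∀ r ∈ pt, r.length = q.length) (hvals : ∀ r ∈ vals, r.length = q.length) (g : List Bool) :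
    (gateVal p V q pt vals g).length = q.length := by
  unfold gateVal; split_ifs
  · exact length_prodVal _ _ _ _ _
  · exact length_sumVal hpt hvals _

/-- Every gate row is `≤ |q|` long, and there are as many rows as gates. [folklore] -/
private theorem length_valsOf_le (V : ℕ) (q : List (ZMod p)) (pt : List (List (ZMod p))) (gcodes : List (List Bool)) :
    (valsOf p V q pt gcodes).length = gcodes.length ∧ ∀ r ∈ valsOf p V q pt gcodes, r.length ≤ q.length := by
  rw [valsOf]
  suffices h : ∀ (gs : List (List Bool)) (vals : List (List (ZMod p))), (∀ r ∈ vals, r.length ≤ q.length) →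
      (gs.foldl (fun vals g => vals ++ [gateVal p V q pt vals g]) vals).length = vals.length + gs.length ∧
      ∀ r ∈ gs.foldl (fun vals g => vals ++ [gateVal p V q pt vals g]) vals, r.length ≤ q.length from by
    simpa using h gcodes [] (by simp)
  intro gs
  induction gs with
  | nil => intro vals h; simpa using h
  | cons g gs ih =>
    intro vals hvals
    rw [List.foldl_cons]
    obtain ⟨h1, h2⟩ := ih (vals ++ [gateVal p V q pt vals g]) (fun r hr => by
      rw [List.mem_append, List.mem_singleton] at hr
      rcases hr with hr | rfl
      · exact hvals r hr
      · exact length_gateVal_le _ _ _ _ _)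
    refine ⟨?_, h2⟩
    rw [h1, List.length_append, List.length_singleton, List.length_cons]; omega

/-- Every gate row has length `|q|` when the point rows do. [folklore] -/
private theorem length_of_mem_valsOf {V : ℕ} {q : List (ZMod p)} {pt : List (List (ZMod p))}
    (hpt : ∀ r ∈ pt, r.length = q.length) (gcodes : List (List Bool)) :
    ∀ r ∈ valsOf p V q pt gcodes, r.length = q.length := by
  rw [valsOf]
  suffices h : ∀ (gs : List (List Bool)) (vals : List (List (ZMod p))), (∀ r ∈ vals, r.length = q.length) →
      ∀ r ∈ gs.foldl (fun vals g => vals ++ [gateVal p V q pt vals g]) vals, r.length = q.length from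
    h gcodes [] (by simp)
  intro gs
  induction gs with
  | nil => intro vals h; simpa using h
  | cons g gs ih =>
    intro vals hvals
    rw [List.foldl_cons]
    exact ih _ fun r hr => by
      rw [List.mem_append, List.mem_singleton] at hr
      rcases hr with hr | rfl
      · exact hvals r hr
      · exact length_gateVal hpt hvals _

/-- **The output row has length `|q|`** when the point rows do. [cite: GathenGerhard1999, §4.1] -/
theorem length_evalRow {V : ℕ} {q : List (ZMod p)} {pt : List (List (ZMod p))}
    (hpt : ∀ r ∈ pt, r.length = q.length) (w : List Bool) : (evalRow p V q pt w).length = q.length :=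
  length_opVal hpt (length_of_mem_valsOf hpt _) _

end Lengths

/-! ### The semantic bridge: rows are the gate values in `𝔽_p[X]/(f)` -/

section Bridge

variable {p} [hp : Fact p.Prime]

/-- The evaluation of integer polynomials at the point of the rows `pt` in `𝔽_p[X]/(f)`. [cite: Schwartz1980, §3] -/
def φ (k : ℕ) (f : (ZMod p)[X]) (pt : List (List (ZMod p))) (V : ℕ) : MvPolynomial (Fin V) ℤ →+* AdjoinRoot f :=
  MvPolynomial.eval₂Hom (Int.castRingHom (AdjoinRoot f))
    fun i => AdjoinRoot.mk f (GFDesign.ofList p (pt.getD i (zeroRow p k)))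

/-- The class of a row. [folklore] -/
def cls (f : (ZMod p)[X]) (r : List (ZMod p)) : AdjoinRoot f := AdjoinRoot.mk f (GFDesign.ofList p r)

/-- The class of the zero row is `0`. [folklore] -/
@[simp] private theorem cls_zeroRow (f : (ZMod p)[X]) (k : ℕ) : cls f (zeroRow p k) = 0 := by
  rw [cls, zeroRow, GFDesign.ofList_replicate_zero, map_zero]

/-- The class of a constant row is the constant. [folklore] -/
private theorem cls_constRow {k : ℕ} (hk : k ≠ 0) (f : (ZMod p)[X]) (c : ZMod p) :
    cls f (constRow p k c) = algebraMap (ZMod p) (AdjoinRoot f) c := by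
  rw [cls, constRow, GFDesign.ofList_smulL, GFDesign.ofList_oneL p hk, mul_one, AdjoinRoot.mk_C,
    AdjoinRoot.algebraMap_eq]

/-- **Operands**: the class of the row of an operand code is the value of `rdOp` under `φ`, provided the
gate rows are the classes of the gate values. [cite: KabanetsImpagliazzo2004, §2] -/
private theorem cls_opVal {V k : ℕ} (hk : k ≠ 0) {f : (ZMod p)[X]} {pt vals : List (List (ZMod p))}
    {VALS : List (MvPolynomial (Fin V) ℤ)}
    (hvals : List.Forall₂ (fun r P => cls f r = φ k f pt V P) vals VALS) (u : List Bool) :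
    cls f (opVal p V k pt vals u) = φ k f pt V ((rdOp V u).eval VALS) := by
  unfold opVal rdOp
  by_cases h1 : u.headD false
  · simp only [h1, if_true, Operand.eval]
    -- gate reference
    have hlen : vals.length = VALS.length := hvals.length_eq
    rcases lt_or_ge (bitsToNat u.tail) vals.length with h | h
    · have h' : bitsToNat u.tail < VALS.length := hlen ▸ h
      have hR := List.Forall₂.get hvals h h'
      rw [List.getD_eq_getElem _ _ h, List.getD_eq_getElem _ _ h']
      simpa using hR
    · have h' : VALS.length ≤ bitsToNat u.tail := hlen ▸ h
      rw [List.getD_eq_default _ _ h, List.getD_eq_default _ _ h', cls_zeroRow, map_zero]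
  · simp only [h1, Bool.false_eq_true, if_false]
    by_cases h2 : u.tail.headD false
    · simp only [h2, if_true, Operand.eval]
      rw [cls_constRow hk, map_intCast, φ, MvPolynomial.coe_eval₂Hom, MvPolynomial.eval₂_C, eq_intCast]
    · simp only [h2, Bool.false_eq_true, if_false]
      by_cases h3 : bitsToNat u.tail.tail < V
      · simp only [h3, if_true, dif_pos, Operand.eval]
        rw [φ, MvPolynomial.coe_eval₂Hom, MvPolynomial.eval₂_X, cls]
      · simp only [h3, if_false, dif_neg, not_false_eq_true, Operand.eval]
        rw [cls_constRow hk, map_zero, MvPolynomial.C_0, map_zero]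

/-- **Product gates**: the class of the product row is the product of the classes.
[cite: GathenGerhard1999, §4.2] -/
private theorem cls_prodVal {V : ℕ} {q : List (ZMod p)} (hq : q.length ≠ 0) {f : (ZMod p)[X]}
    (hf : f = X ^ q.length + GFDesign.ofList p q) {pt vals : List (List (ZMod p))}
    {VALS : List (MvPolynomial (Fin V) ℤ)}
    (hvals : List.Forall₂ (fun r P => cls f r = φ q.length f pt V P) vals VALS) (items : List (List Bool)) :
    cls f (prodVal p V q pt vals items) =
      φ q.length f pt V ((Gate.prod (k := ℤ) ((items.map (rdOp V)))).eval VALS) := by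
  rw [Gate.eval, List.map_map, map_list_prod, List.map_map, prodVal]
  suffices h : ∀ (its : List (List Bool)) (acc : List (ZMod p)) (A : AdjoinRoot f), acc.length = q.length →
      cls f acc = A →
      cls f (its.foldl (fun acc it => GFDesign.mulmodL p q acc (opVal p V q.length pt vals it)) acc) =
        A * (its.map (⇑(φ q.length f pt V) ∘ (fun u => Operand.eval VALS u) ∘ rdOp V)).prod by
    rw [h items _ 1 (by simp) (by rw [cls, GFDesign.ofList_oneL p hq, map_one]), one_mul]
  intro its
  induction its with
  | nil => intro acc A _ hA; simpa using hA
  | cons it its ih =>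
    intro acc A hacc hA
    rw [List.foldl_cons, List.map_cons, List.prod_cons, ← mul_assoc]
    refine ih _ _ (GFDesign.length_mulmodL p rfl hacc _) ?_
    rw [cls, GFDesign.mk_ofList_mulmodL p rfl hacc hq hf, ← cls, ← cls, hA, cls_opVal hq hvals]
    rfl

/-- **Weighted-sum gates**: the class of the sum row is the weighted sum of the classes.
[cite: GathenGerhard1999, §4.1] -/
private theorem cls_sumVal {V : ℕ} {q : List (ZMod p)} (hq : q.length ≠ 0) {f : (ZMod p)[X]}
    {pt vals : List (List (ZMod p))} (hpt : ∀ r ∈ pt, r.length = q.length) (hvl : ∀ r ∈ vals, r.length = q.length)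
    {VALS : List (MvPolynomial (Fin V) ℤ)}
    (hvals : List.Forall₂ (fun r P => cls f r = φ q.length f pt V P) vals VALS) (items : List (List Bool)) :
    cls f (sumVal p V q pt vals items) =
      φ q.length f pt V ((Gate.sum ((items.map fun it => (rdInt (fstF it), rdOp V (sndF it))))).eval VALS) := by
  rw [Gate.eval, List.map_map, map_list_sum, List.map_map, sumVal]
  suffices h : ∀ (its : List (List Bool)) (acc : List (ZMod p)) (A : AdjoinRoot f), acc.length = q.length →
      cls f acc = A →
      cls f (its.foldl (fun acc it => GFDesign.addL p acc
          (GFDesign.smulL p (rdInt (fstF it) : ZMod p) (opVal p V q.length pt vals (sndF it)))) acc) =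
        A + (its.map (⇑(φ q.length f pt V) ∘ (fun a : ℤ × Operand ℤ (Fin V) => a.1 • Operand.eval VALS a.2) ∘
          fun it => (rdInt (fstF it), rdOp V (sndF it)))).sum by
    rw [h items _ 0 (by simp) (by rw [cls_zeroRow]), zero_add]
  intro its
  induction its with
  | nil => intro acc A _ hA; simpa using hA
  | cons it its ih =>
    intro acc A hacc hA
    rw [List.foldl_cons, List.map_cons, List.sum_cons, ← add_assoc]
    have hlen : (GFDesign.smulL p (rdInt (fstF it) : ZMod p) (opVal p V q.length pt vals (sndF it))).length = q.length := by
      rw [GFDesign.length_smulL, length_opVal hpt hvl]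
    refine ih _ _ (by rw [GFDesign.length_addL, hacc, hlen, min_self]) ?_
    rw [cls, GFDesign.ofList_addL p _ _ (by rw [hacc, hlen]), GFDesign.ofList_smulL, map_add, map_mul,
      AdjoinRoot.mk_C, ← cls, ← cls, hA, cls_opVal hq hvals]
    simp only [Function.comp_apply, zsmul_eq_mul, map_mul, map_intCast]

/-- **Gates**: the class of a gate row is the gate's value under `φ`. [cite: KabanetsImpagliazzo2004, §2] -/
private theorem cls_gateVal {V : ℕ} {q : List (ZMod p)} (hq : q.length ≠ 0) {f : (ZMod p)[X]}
    (hf : f = X ^ q.length + GFDesign.ofList p q) {pt vals : List (List (ZMod p))}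
    (hpt : ∀ r ∈ pt, r.length = q.length) (hvl : ∀ r ∈ vals, r.length = q.length)
    {VALS : List (MvPolynomial (Fin V) ℤ)}
    (hvals : List.Forall₂ (fun r P => cls f r = φ q.length f pt V P) vals VALS) (g : List Bool) :
    cls f (gateVal p V q pt vals g) = φ q.length f pt V ((rdGate V g).eval VALS) := by
  unfold gateVal rdGate
  split_ifs
  · exact cls_prodVal hq hf hvals _
  · exact cls_sumVal hq hpt hvl hvals _

/-- **All gates**: the gate rows are the classes of `ArithCircuit.gateValues`. [cite: KabanetsImpagliazzo2004, §2] -/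
private theorem forall₂_valsOf {V : ℕ} {q : List (ZMod p)} (hq : q.length ≠ 0) {f : (ZMod p)[X]}
    (hf : f = X ^ q.length + GFDesign.ofList p q) {pt : List (List (ZMod p))}
    (hpt : ∀ r ∈ pt, r.length = q.length) (gcodes : List (List Bool)) :
    List.Forall₂ (fun r P => cls f r = φ q.length f pt V P) (valsOf p V q pt gcodes)
      (gateValues (gcodes.map (rdGate V))) := by
  rw [valsOf, gateValues, List.foldl_map]
  suffices h : ∀ (gs : List (List Bool)) (vals : List (List (ZMod p))) (VALS : List (MvPolynomial (Fin V) ℤ)),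
      (∀ r ∈ vals, r.length = q.length) →
      List.Forall₂ (fun r P => cls f r = φ q.length f pt V P) vals VALS →
      List.Forall₂ (fun r P => cls f r = φ q.length f pt V P)
        (gs.foldl (fun vals g => vals ++ [gateVal p V q pt vals g]) vals)
        (gs.foldl (fun VALS g => VALS ++ [(rdGate V g).eval VALS]) VALS) from
    h gcodes [] [] (by simp) List.Forall₂.nil
  intro gs
  induction gs with
  | nil => intro vals VALS _ h; simpa using h
  | cons g gs ih =>
    intro vals VALS hvl hvals
    rw [List.foldl_cons, List.foldl_cons]
    refine ih _ _ (fun r hr => ?_) (List.rel_append hvals (List.Forall₂.cons (cls_gateVal hq hf hpt hvl hvals g) List.Forall₂.nil))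
    rw [List.mem_append, List.mem_singleton] at hr
    rcases hr with hr | rfl
    · exact hvl r hr
    · exact length_gateVal hpt hvl _

/-- **The semantic bridge.** For a modulus row `q` of length `k ≥ 1` and point rows of length `k`, the
class in `𝔽_p[X]/(f)`, `f = X^k + ofList q`, of the output row of the evaluator on ANY string `w` is the
value of the polynomial of the circuit read off `w`, `eval₂ (ℤ → 𝔽_p[X]/(f)) (point) (rdCircuit V w).eval`.
[cite: Schwartz1980, §3] [cite: KabanetsImpagliazzo2004, §2] -/
theorem cls_evalRow {V : ℕ} {q : List (ZMod p)} (hq : q.length ≠ 0) {f : (ZMod p)[X]}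
    (hf : f = X ^ q.length + GFDesign.ofList p q) {pt : List (List (ZMod p))}
    (hpt : ∀ r ∈ pt, r.length = q.length) (w : List Bool) :
    cls f (evalRow p V q pt w) = φ q.length f pt V (rdCircuit V w).eval := by
  rw [evalRow, ArithCircuit.eval, rdCircuit]
  exact cls_opVal hq (forall₂_valsOf hq hf hpt _) _

/-- **`φ` is evaluation at the point `ptOf` after reduction mod `p`**: when the point rows are the
`{0,1}` rows of the blocks of `z`, `φ P = aeval (ptOf p k V f z) (map (ℤ → 𝔽_p) P)`.
[cite: Schwartz1980, Lemma 1] -/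
theorem φ_eq_aeval {k V : ℕ} (f : (ZMod p)[X]) (z : List Bool) (P : MvPolynomial (Fin V) ℤ) :
    φ k f ((List.range V).map fun i => bitRow p k ((z.drop (i * k)).take k)) V P =
      MvPolynomial.aeval (ptOf p k V f z) (MvPolynomial.map (Int.castRingHom (ZMod p)) P) := by
  rw [MvPolynomial.aeval_def, MvPolynomial.eval₂_map, φ, MvPolynomial.coe_eval₂Hom]
  have hring : (algebraMap (ZMod p) (AdjoinRoot f)).comp (Int.castRingHom (ZMod p)) = Int.castRingHom (AdjoinRoot f) :=
    RingHom.ext_int _ _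
  rw [hring]
  congr 1
  funext i
  rw [ptOf, List.getD_eq_getElem _ _ (by simp [i.isLt]), List.getElem_map, List.getElem_range]

end Bridge

/-! ### The program is polynomial time on codes -/

section Codes

variable {p} [hp : Fact p.Prime]

/-- Lists of rows: the raw list of the row codes. [folklore] -/
abbrev rowsE (p : ℕ) : List (List (ZMod p)) → List Bool := rawE (rowE p)

/-- The context `(V, q, pt)`: binary `V`, the modulus row, the point rows. [folklore] -/
abbrev ctxE (p : ℕ) : ℕ × List (ZMod p) × List (List (ZMod p)) → List Bool :=
  pairE natE (pairE (rowE p) (rowsE p))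

/-- The value context `((V, q, pt), vals)`. [folklore] -/
abbrev vcE (p : ℕ) : (ℕ × List (ZMod p) × List (List (ZMod p))) × List (List (ZMod p)) → List Bool :=
  pairE (ctxE p) (rowsE p)

omit hp in
/-- First pair component, on strings. [folklore] -/
private theorem strFst : CodeFP strE strE fstF := of_fn fstF fstF_mem_FP fun _ => rfl

omit hp in
/-- Second pair component, on strings. [folklore] -/
private theorem strSnd : CodeFP strE strE sndF := of_fn sndF sndF_mem_FP fun _ => rfl

omit hp in
/-- Tail of a string (`drop 1`). [folklore] -/
private theorem strTail : CodeFP strE strE List.tail :=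
  (strDrop.comp ((const strE 1).pair (CodeFP.id strE))).congr fun s => by simp

omit hp in
/-- Head bit of a string (`false` on `ε`). [folklore] -/
private theorem strHeadD : CodeFP strE bitE (fun s : List Bool => s.headD false) :=
  (strGetD.comp ((const strE 0).pair (CodeFP.id strE))).congr fun s => by cases s <;> rfl

/-- **Reduction of an integer mod `p` on codes** (sign and magnitude). [cite: AroraBarakCC2009, §1.3] -/
theorem intToZMod : CodeFP intE (zmodE p) (fun z : ℤ => (z : ZMod p)) :=
  ((intLt.comp ((CodeFP.id intE).pair (const intE (0 : ℤ)))).ite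
    (GFDesign.zmodNeg.comp (zmodOfNat.comp intNatAbs)) (zmodOfNat.comp intNatAbs)).congr fun z => by
    dsimp only [id]
    split_ifs with h
    · have hz : z < 0 := by simpa using h
      have habs : ((z.natAbs : ℕ) : ℤ) = -z := Int.ofNat_natAbs_of_nonpos hz.le
      rw [← Int.cast_natCast (R := ZMod p), habs, Int.cast_neg, neg_neg]
    · have hz : ¬ z < 0 := by simpa using h
      rw [← Int.cast_natCast (R := ZMod p), Int.natAbs_of_nonneg (not_lt.1 hz)]

/-- A `{0,1}` residue from a bit. [folklore] -/
private theorem bitToZMod : CodeFP bitE (zmodE p) (fun c : Bool => if c then (1 : ZMod p) else 0) :=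
  (CodeFP.id bitE).ite (const bitE (1 : ZMod p)) (const bitE (0 : ZMod p))

/-- The zero row of the length of a given row, on codes. [folklore] -/
private theorem zeroRow_codeFP : CodeFP (rowE p) (rowE p) (fun q : List (ZMod p) => zeroRow p q.length) :=
  ((replicateOf (zmodE p)).comp ((const _ (0 : ZMod p)).pair (ulength (zmodE p)))).congr fun _ => rfl

/-- The constant row of the length of a given row, on codes. [cite: GathenGerhard1999, §4.1] -/
private theorem constRow_codeFP :
    CodeFP (pairE (rowE p) (zmodE p)) (rowE p) (fun t => constRow p t.1.length t.2) :=
  (GFDesign.codeFP_smulL.comp ((snd _ _).pair (GFDesign.codeFP_oneL.comp (fst _ _)))).congr fun _ => rfl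

/-- **Operand rows on codes**: `(((V, q, pt), vals), u) ↦ opVal V |q| pt vals u`. [cite: KabanetsImpagliazzo2004, §2] [cite: AroraBarakCC2009, §1.3] -/
theorem opVal_codeFP : CodeFP (pairE (vcE p) strE) (rowE p)
    (fun t => opVal p t.1.1.1 t.1.1.2.1.length t.1.1.2.2 t.1.2 t.2) := by
  have hu : CodeFP (pairE (vcE p) strE) strE (fun t => t.2) := snd _ _
  have hV : CodeFP (pairE (vcE p) strE) natE (fun t => t.1.1.1) := (fst _ _).fst'.fst'
  have hq : CodeFP (pairE (vcE p) strE) (rowE p) (fun t => t.1.1.2.1) := (fst _ _).fst'.snd'.fst'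
  have hpt : CodeFP (pairE (vcE p) strE) (rowsE p) (fun t => t.1.1.2.2) := (fst _ _).fst'.snd'.snd'
  have hvals : CodeFP (pairE (vcE p) strE) (rowsE p) (fun t => t.1.2) := (fst _ _).snd'
  have hut : CodeFP (pairE (vcE p) strE) strE (fun t => t.2.tail) := strTail.comp hu
  have hutt : CodeFP (pairE (vcE p) strE) strE (fun t => t.2.tail.tail) := strTail.comp hut
  have hzero : CodeFP (pairE (vcE p) strE) (rowE p) (fun t => zeroRow p t.1.1.2.1.length) := zeroRow_codeFP.comp hq
  have hgate : CodeFP (pairE (vcE p) strE) (rowE p)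
      (fun t => t.1.2.getD (bitsToNat t.2.tail) (zeroRow p t.1.1.2.1.length)) :=
    (rawGetOr (rowE p)).comp (hvals.pair ((strVal.comp hut).pair hzero))
  have hconst : CodeFP (pairE (vcE p) strE) (rowE p)
      (fun t => constRow p t.1.1.2.1.length (rdInt t.2.tail.tail : ZMod p)) :=
    constRow_codeFP.comp (hq.pair (intToZMod.comp (PITCodeFP.rdInt_codeFP.comp hutt)))
  have hvar : CodeFP (pairE (vcE p) strE) (rowE p)
      (fun t => t.1.1.2.2.getD (bitsToNat t.2.tail.tail) (zeroRow p t.1.1.2.1.length)) :=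
    (rawGetOr (rowE p)).comp (hpt.pair ((strVal.comp hutt).pair hzero))
  have hc0 : CodeFP (pairE (vcE p) strE) (rowE p) (fun t => constRow p t.1.1.2.1.length 0) :=
    constRow_codeFP.comp (hq.pair (const _ (0 : ZMod p)))
  have h := (strHeadD.comp hu).ite hgate ((strHeadD.comp hut).ite hconst
    ((natLt.comp ((strVal.comp hutt).pair hV)).ite hvar hc0))
  refine h.congr fun t => ?_
  simp only [opVal, decide_eq_true_eq]

/-- A row of length `≤ |q|` has a code at most `(entryLen + 1) · |rowE q|` long. [folklore] -/
private theorem length_rowE_le_mul {r q : List (ZMod p)} (h : r.length ≤ q.length) :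
    (rowE p r).length ≤ (entryLen p + 1) * (rowE p q).length :=
  calc (rowE p r).length ≤ q.length * (2 * entryLen p + 2) := GFDesign.length_rowE_le_of_le h
    _ = (entryLen p + 1) * (2 * q.length) := by ring
    _ ≤ (entryLen p + 1) * (rowE p q).length := Nat.mul_le_mul_left _ (two_mul_length_le_length_rowE q)

omit hp in
/-- The modulus row is a substring of the code of `((V, q, pt), vals), items)`. [folklore] -/
private theorem length_rowE_q_le (t : ((ℕ × List (ZMod p) × List (List (ZMod p))) × List (List (ZMod p))) × List (List Bool)) :
    (rowE p t.1.1.2.1).length ≤ (pairE (vcE p) (rawE strE) t).length := by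
  obtain ⟨⟨⟨V, q, pt⟩, vals⟩, l⟩ := t
  simp only [pairE_apply, length_boolPair]
  omega

/-- **Product rows on codes**: `(((V, q, pt), vals), items) ↦ prodVal V q pt vals items` (a fold whose
accumulator is a row of length `≤ |q|`). [cite: GathenGerhard1999, §4.2] [cite: AroraBarakCC2009, §1.3] -/
theorem prodVal_codeFP : CodeFP (pairE (vcE p) (rawE strE)) (rowE p)
    (fun t => prodVal p t.1.1.1 t.1.1.2.1 t.1.1.2.2 t.1.2 t.2) := by
  have hstep : CodeFP (pairE (vcE p) (pairE strE (rowE p))) (rowE p)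
      (fun t => GFDesign.mulmodL p t.1.1.2.1 t.2.2 (opVal p t.1.1.1 t.1.1.2.1.length t.1.1.2.2 t.1.2 t.2.1)) :=
    GFDesign.codeFP_mulmodL.comp ((fst _ _).fst'.snd'.fst'.pair ((snd _ _).snd'.pair
      (opVal_codeFP.comp ((fst _ _).pair (snd _ _).fst'))))
  have hinit : CodeFP (vcE p) (rowE p) (fun s => GFDesign.oneL p s.1.2.1.length) :=
    GFDesign.codeFP_oneL.comp (fst _ _).snd'.fst'
  have h := foldl (σ := (ℕ × List (ZMod p) × List (List (ZMod p))) × List (List (ZMod p))) (α := List Bool)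
    (β := List (ZMod p)) (eσ := vcE p) (eα := strE) (eβ := rowE p)
    (step := fun s it acc => GFDesign.mulmodL p s.1.2.1 acc (opVal p s.1.1 s.1.2.1.length s.1.2.2 s.2 it))
    (init := fun s => GFDesign.oneL p s.1.2.1.length) hstep hinit (Polynomial.C (entryLen p + 1) * X)
    (fun s l₁ l₂ => by
      rw [Polynomial.eval_mul, Polynomial.eval_C, Polynomial.eval_X]
      have hacc := length_prodFold_le (p := p) s.1.1 s.1.2.1 s.1.2.2 s.2 l₁ (GFDesign.oneL p s.1.2.1.length) (by simp)
      exact (length_rowE_le_mul hacc).trans (Nat.mul_le_mul_left _ (length_rowE_q_le (s, l₁ ++ l₂))))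
  exact h.congr fun t => rfl

/-- **Sum rows on codes**: `(((V, q, pt), vals), items) ↦ sumVal V q pt vals items`.
[cite: GathenGerhard1999, §4.1] [cite: AroraBarakCC2009, §1.3] -/
theorem sumVal_codeFP : CodeFP (pairE (vcE p) (rawE strE)) (rowE p)
    (fun t => sumVal p t.1.1.1 t.1.1.2.1 t.1.1.2.2 t.1.2 t.2) := by
  have hstep : CodeFP (pairE (vcE p) (pairE strE (rowE p))) (rowE p)
      (fun t => GFDesign.addL p t.2.2 (GFDesign.smulL p (rdInt (fstF t.2.1) : ZMod p)
        (opVal p t.1.1.1 t.1.1.2.1.length t.1.1.2.2 t.1.2 (sndF t.2.1)))) :=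
    GFDesign.codeFP_addL.comp ((snd _ _).snd'.pair (GFDesign.codeFP_smulL.comp
      ((intToZMod.comp (PITCodeFP.rdInt_codeFP.comp (strFst.comp (snd _ _).fst'))).pair
        (opVal_codeFP.comp ((fst _ _).pair (strSnd.comp (snd _ _).fst'))))))
  have hinit : CodeFP (vcE p) (rowE p) (fun s => zeroRow p s.1.2.1.length) :=
    zeroRow_codeFP.comp (fst _ _).snd'.fst'
  have h := foldl (σ := (ℕ × List (ZMod p) × List (List (ZMod p))) × List (List (ZMod p))) (α := List Bool)
    (β := List (ZMod p)) (eσ := vcE p) (eα := strE) (eβ := rowE p)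
    (step := fun s it acc => GFDesign.addL p acc (GFDesign.smulL p (rdInt (fstF it) : ZMod p)
      (opVal p s.1.1 s.1.2.1.length s.1.2.2 s.2 (sndF it))))
    (init := fun s => zeroRow p s.1.2.1.length) hstep hinit (Polynomial.C (entryLen p + 1) * X)
    (fun s l₁ l₂ => by
      rw [Polynomial.eval_mul, Polynomial.eval_C, Polynomial.eval_X]
      have hacc := length_sumFold_le (p := p) s.1.1 s.1.2.1 s.1.2.2 s.2 l₁ (zeroRow p s.1.2.1.length) s.1.2.1.length (by simp)
      exact (length_rowE_le_mul hacc).trans (Nat.mul_le_mul_left _ (length_rowE_q_le (s, l₁ ++ l₂))))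
  exact h.congr fun t => rfl

/-- **Gate rows on codes**: `(((V, q, pt), vals), g) ↦ gateVal V q pt vals g`. [cite: KabanetsImpagliazzo2004, §2] -/
theorem gateVal_codeFP : CodeFP (pairE (vcE p) strE) (rowE p)
    (fun t => gateVal p t.1.1.1 t.1.1.2.1 t.1.1.2.2 t.1.2 t.2) := by
  have hitems : CodeFP (pairE (vcE p) strE) (pairE (vcE p) (rawE strE)) (fun t => (t.1, rdItems t.2)) :=
    (fst _ _).pair (PITCodeFP.rdItems_codeFP.comp (snd _ _))
  exact ((strHeadD.comp (snd _ _)).ite (prodVal_codeFP.comp hitems) (sumVal_codeFP.comp hitems)).congr fun t => by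
    simp only [gateVal]

omit hp in
/-- The modulus row is a substring of the code of `((V, q, pt), gcodes)`. [folklore] -/
private theorem length_rowE_q_le' (t : (ℕ × List (ZMod p) × List (List (ZMod p))) × List (List Bool)) :
    (rowE p t.1.2.1).length ≤ (pairE (ctxE p) (rawE strE) t).length := by
  obtain ⟨⟨V, q, pt⟩, l⟩ := t
  simp only [pairE_apply, length_boolPair]
  omega

/-- **All gate rows on codes**: `((V, q, pt), gcodes) ↦ valsOf V q pt gcodes` — a fold whose accumulator,
the raw list of rows of length `≤ |q|`, grows by one row per gate (a polynomial bound in the input).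
[cite: KabanetsImpagliazzo2004, §2] [cite: AroraBarakCC2009, §1.3 (polynomially bounded loops)] -/
theorem valsOf_codeFP : CodeFP (pairE (ctxE p) (rawE strE)) (rowsE p)
    (fun t => valsOf p t.1.1 t.1.2.1 t.1.2.2 t.2) := by
  have hstep : CodeFP (pairE (ctxE p) (pairE strE (rowsE p))) (rowsE p)
      (fun t => t.2.2 ++ [gateVal p t.1.1 t.1.2.1 t.1.2.2 t.2.2 t.2.1]) :=
    (rawAppend (rowE p)).comp ((snd _ _).snd'.pair ((rawSingleton (rowE p)).comp
      (gateVal_codeFP.comp (((fst _ _).pair (snd _ _).snd').pair (snd _ _).fst'))))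
  have h := foldl (σ := ℕ × List (ZMod p) × List (List (ZMod p))) (α := List Bool)
    (β := List (List (ZMod p))) (eσ := ctxE p) (eα := strE) (eβ := rowsE p)
    (step := fun s g vals => vals ++ [gateVal p s.1 s.2.1 s.2.2 vals g])
    (init := fun _ => []) hstep (const _ []) (X * (Polynomial.C (2 * (entryLen p + 1)) * X + Polynomial.C 2))
    (fun s l₁ l₂ => by
      rw [Polynomial.eval_mul, Polynomial.eval_add, Polynomial.eval_mul, Polynomial.eval_C, Polynomial.eval_X, Polynomial.eval_C]
      set N := (pairE (ctxE p) (rawE strE) (s, l₁ ++ l₂)).length with hN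
      have hvals := length_valsOf_le (p := p) s.1 s.2.1 s.2.2 l₁
      rw [valsOf] at hvals
      set vals := l₁.foldl (fun vals g => vals ++ [gateVal p s.1 s.2.1 s.2.2 vals g]) []
      have hq : (rowE p s.2.1).length ≤ N := length_rowE_q_le' (s, l₁ ++ l₂)
      have hl : l₁.length ≤ N := by
        refine le_trans ?_ (le_trans (length_le_length_rawE strE (l₁ ++ l₂)) ?_)
        · simp
        · simp only [hN, pairE_apply, length_boolPair]; omega
      have hitem : ∀ r ∈ vals, 2 * (rowE p r).length + 2 ≤ 2 * (entryLen p + 1) * N + 2 := fun r hr => by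
        have := (length_rowE_le_mul (hvals.2 r hr)).trans (Nat.mul_le_mul_left _ hq)
        nlinarith
      calc (rowsE p vals).length = (vals.map fun r => 2 * (rowE p r).length + 2).sum := length_rawE _ _
        _ ≤ (vals.map fun _ => 2 * (entryLen p + 1) * N + 2).sum := List.sum_le_sum fun r hr => hitem r hr
        _ = vals.length * (2 * (entryLen p + 1) * N + 2) := by rw [List.map_const', List.sum_replicate, smul_eq_mul]
        _ ≤ N * (2 * (entryLen p + 1) * N + 2) := Nat.mul_le_mul_right _ (hvals.1 ▸ hl))
  exact h.congr fun t => rfl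

/-- **The output row on codes**: `((V, q, pt), w) ↦ evalRow V q pt w`. [cite: Schwartz1980, §3] [cite: AroraBarakCC2009, §1.3] -/
theorem evalRow_codeFP : CodeFP (pairE (ctxE p) strE) (rowE p) (fun t => evalRow p t.1.1 t.1.2.1 t.1.2.2 t.2) :=
  (opVal_codeFP.comp (((fst _ _).pair (valsOf_codeFP.comp ((fst _ _).pair (PITCodeFP.rdGateCodes_codeFP.comp (snd _ _))))).pair
    (PITCodeFP.rdOutCode_codeFP.comp (snd _ _)))).congr fun _ => rfl

/-! ### Reading the modulus row and the point rows off the coins -/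

/-- **The modulus row on codes**: `((1^k, 1^b), y) ↦ modRow p b k y` (cut `k` blocks of `b` coins, reduce
their values mod `p`). [cite: AroraBarakCC2009, Lemma A.31 (coins to residues)] -/
theorem modRow_codeFP : CodeFP (pairE (pairE unE unE) strE) (rowE p) (fun t => modRow p t.1.2 t.1.1 t.2) := by
  have hch := strChunks.comp (((fst _ _).fst'.pair ((fst _ _).snd'.pair (snd _ _))) :
    CodeFP (pairE (pairE unE unE) strE) (pairE unE (pairE unE strE)) (fun t => (t.1.1, (t.1.2, t.2))))
  refine ((map₀ (zmodOfNat.comp strVal)).comp hch).congr fun t => ?_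
  simp only [modRow, List.map_map]
  rfl

/-- A `{0,1}` row from a block, on codes: `(1^k, u) ↦ bitRow p k u`. [cite: Schwartz1980, Lemma 1] -/
theorem bitRow_codeFP : CodeFP (pairE unE strE) (rowE p) (fun t => bitRow p t.1 t.2) :=
  ((map₀ bitToZMod).comp GFDesign.codeFP_bitsOf).congr fun _ => rfl

/-- **The point rows on codes**: `((1^V, 1^k), z) ↦ [bitRow p k z[ik, ik + k) | i < V]`.
[cite: Schwartz1980, Lemma 1] [cite: AroraBarakCC2009, Lemma 7.5] -/
theorem ptRows_codeFP : CodeFP (pairE (pairE unE unE) strE) (rowsE p)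
    (fun t => (List.range t.1.1).map fun i => bitRow p t.1.2 ((t.2.drop (i * t.1.2)).take t.1.2)) := by
  have hch := strChunks.comp (((fst _ _).fst'.pair ((fst _ _).snd'.pair (snd _ _))) :
    CodeFP (pairE (pairE unE unE) strE) (pairE unE (pairE unE strE)) (fun t => (t.1.1, (t.1.2, t.2))))
  have hm := (map (σ := ℕ) (eσ := unE) (eα := strE) (eβ := rowE p) (g := fun x => bitRow p x.1 x.2)
    bitRow_codeFP).comp ((fst _ _).snd'.pair hch)
  refine hm.congr fun t => ?_
  simp only [List.map_map]
  rfl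

end Codes

/-! ### The machine: parameters from `|w|`, readers, evaluator, zero test -/

section Machine

variable {p} [hp : Fact p.Prime]

variable (p) (v d : Polynomial ℕ)

/-- **The row the machine tests for zero**: the output row of the circuit read off `w` over `V = v(|w|)`
variables, modulo the monic read off the first `k b` coins of `y`, at the point rows read off the rest
(`k = kOf d |w|`, `b = bOf p d |w|`). [cite: Schwartz1980, §3] [cite: AgrawalBiswas2003, §1] -/
def resultRow (w y : List Bool) : List (ZMod p) :=
  evalRow p (v.eval w.length) (modRow p (bOf p d w.length) (kOf d w.length) y)
    ((List.range (v.eval w.length)).map fun i => bitRow p (kOf d w.length)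
      (((y.drop (kOf d w.length * bOf p d w.length)).drop (i * kOf d w.length)).take (kOf d w.length))) w

/-- **The machine's answer** on `⟨w, y⟩`: is the output row the zero row? [cite: Schwartz1980, §3] -/
def acceptBit (wy : List Bool × List Bool) : Bool :=
  decide (resultRow p v d wy.1 wy.2 = List.replicate (kOf d wy.1.length) 0)

variable {p v d}

omit hp in
/-- `k` as the value of `kPoly` (plumbing; the twin in `RandomizedExtensionFieldZeroTest.lean` is private). [folklore] -/
private theorem eval_kPoly' (n : ℕ) : (kPoly d).eval n = kOf d n := by simp [kPoly, kOf]

/-- **The answer is computed in polynomial time on codes.** [cite: AroraBarakCC2009, §1.3] [cite: KabanetsImpagliazzo2004, §2] -/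
theorem acceptBit_codeFP : CodeFP (pairE strE strE) bitE (acceptBit p v d) := by
  -- a fixed polynomial of a unary numeral, in unary: the brick `Plumb.polyFn` typed (this is the term of
  -- `QuantumComplexity.unPoly_codeFP`, `HidingProgramMachine.lean`, whose import cone does not belong here)
  have unEval : ∀ Q : Polynomial ℕ, CodeFP unE unE (fun n => Q.eval n) := fun Q =>
    ⟨Plumb.polyFn Q, Plumb.polyFn_mem_FP Q, fun n => by rw [Plumb.polyFn_apply, length_unE, unE_eq_ones]⟩
  have hw : CodeFP (pairE strE strE) strE (fun t => t.1) := fst _ _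
  have hy : CodeFP (pairE strE strE) strE (fun t => t.2) := snd _ _
  have hn : CodeFP (pairE strE strE) unE (fun t => t.1.length) := strLength.comp hw
  have hV : CodeFP (pairE strE strE) unE (fun t => v.eval t.1.length) := (unEval v).comp hn
  have hVn : CodeFP (pairE strE strE) natE (fun t => v.eval t.1.length) := natOfUn.comp hV
  have hk : CodeFP (pairE strE strE) unE (fun t => kOf d t.1.length) :=
    ((unEval (kPoly d)).comp hn).congr fun t => eval_kPoly' _
  have hb : CodeFP (pairE strE strE) unE (fun t => bOf p d t.1.length) :=
    ((unEval (Polynomial.C 2 * kPoly d + Polynomial.C (p + 3))).comp hn).congr fun t => by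
      simp only [Polynomial.eval_add, Polynomial.eval_mul, Polynomial.eval_C, eval_kPoly', bOf]; ring
  have hkb : CodeFP (pairE strE strE) unE (fun t => kOf d t.1.length * bOf p d t.1.length) :=
    ((unEval (kPoly d * (Polynomial.C 2 * kPoly d + Polynomial.C (p + 3)))).comp hn).congr fun t => by
      simp only [Polynomial.eval_add, Polynomial.eval_mul, Polynomial.eval_C, eval_kPoly', bOf]; ring
  have hq : CodeFP (pairE strE strE) (rowE p) (fun t => modRow p (bOf p d t.1.length) (kOf d t.1.length) t.2) :=
    modRow_codeFP.comp ((hk.pair hb).pair hy)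
  have hz : CodeFP (pairE strE strE) strE (fun t => t.2.drop (kOf d t.1.length * bOf p d t.1.length)) :=
    strDrop.comp (hkb.pair hy)
  have hpt : CodeFP (pairE strE strE) (rowsE p) (fun t => (List.range (v.eval t.1.length)).map fun i =>
      bitRow p (kOf d t.1.length) (((t.2.drop (kOf d t.1.length * bOf p d t.1.length)).drop
        (i * kOf d t.1.length)).take (kOf d t.1.length))) :=
    ptRows_codeFP.comp ((hV.pair hk).pair hz)
  have hrow : CodeFP (pairE strE strE) (rowE p) (fun t => resultRow p v d t.1 t.2) :=
    (evalRow_codeFP.comp ((hVn.pair (hq.pair hpt)).pair hw)).congr fun t => rfl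
  have hzero : CodeFP (pairE strE strE) (rowE p) (fun t => List.replicate (kOf d t.1.length) (0 : ZMod p)) :=
    (replicateOf (zmodE p)).comp ((const _ (0 : ZMod p)).pair hk)
  exact ((CodeFP.eq (rawE_injective zmodE_injective)).comp (hrow.pair hzero)).congr fun t => rfl

/-- **The answer is the zero test in `𝔽_p[X]/(f)`**: `acceptBit ⟨w, y⟩ = 1` iff the polynomial of the
circuit read off `w`, reduced mod `p`, VANISHES at the point `ptOf` in `𝔽_p[X]/(modPoly p b k y)`
(`mk_ofList_eq_zero_iff`, `cls_evalRow`, `φ_eq_aeval`). [cite: Schwartz1980, §3 and Cor. 1] [cite: AgrawalBiswas2003, §1] -/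
theorem acceptBit_eq_true_iff (w y : List Bool) :
    acceptBit p v d (w, y) = true ↔
      MvPolynomial.aeval
        (ptOf p (kOf d w.length) (v.eval w.length) (modPoly p (bOf p d w.length) (kOf d w.length) y)
          (y.drop (kOf d w.length * bOf p d w.length)))
        (MvPolynomial.map (Int.castRingHom (ZMod p)) (rdCircuit (v.eval w.length) w).eval) = 0 := by
  set n := w.length
  set V := v.eval n
  set k := kOf d n with hk
  set b := bOf p d n
  set q := modRow p b k y with hq
  set f := modPoly p b k y with hf
  set z := y.drop (k * b)
  set pt := (List.range V).map fun i => bitRow p k ((z.drop (i * k)).take k) with hpt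
  have hqk : q.length = k := length_modRow b k y
  have hk0 : q.length ≠ 0 := by rw [hqk, hk]; have := three_le_kOf (d := d) n; omega
  have hfq : f = X ^ q.length + GFDesign.ofList p q := by rw [hqk, hf, hq, modPoly]
  have hptk : ∀ r ∈ pt, r.length = q.length := fun r hr => by
    rw [hpt, List.mem_map] at hr
    obtain ⟨i, -, rfl⟩ := hr
    rw [length_bitRow, hqk]
  have hlen : (resultRow p v d w y).length = k := by
    rw [resultRow, length_evalRow hptk, hqk]
  rw [acceptBit, decide_eq_true_iff]
  change resultRow p v d w y = List.replicate k 0 ↔ _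
  rw [← mk_ofList_eq_zero_iff (natDegree_modPoly b k y) (monic_modPoly b k y).ne_zero hlen]
  change cls f (evalRow p V q pt w) = 0 ↔ _
  rw [cls_evalRow hk0 hfq hptk, hqk, hpt, φ_eq_aeval]

/-- Deciding whether a string is the one-bit string `1`, on strings (plumbing for the one-bit normal
form of the machine). [folklore] -/
private theorem isTrue_codeFP : CodeFP strE bitE (fun s : List Bool => decide (s = [true])) :=
  (CodeFP.eq (eα := strE) fun _ _ h => h).comp ((CodeFP.id strE).pair (const strE [true]))

variable (p v d)

/-- **The `FP` evaluator of integer circuit codes in `𝔽_p[X]/(f)`** — the `hspec` hypothesis of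
`ExtFieldZeroTest.mem_coRP_of_extFieldZeroTest` for the junk-tolerant circuit semantics `rdCircuit`:
a ONE-BIT polynomial-time `E` with `E ⟨w, y⟩ = 1` iff the polynomial of the circuit read off `w` over
`v(|w|)` variables, reduced mod `p`, vanishes at the point of `y` in `𝔽_p[X]/(f_y)`.
[cite: Schwartz1980, §3 and Cor. 1] [cite: AgrawalBiswas2003, §1] [cite: AroraBarakCC2009, §1.3] -/
theorem exists_extEvalF :
    ∃ E : List Bool → List Bool, E ∈ FP ∧ (∀ z, E z = [true] ∨ E z = [false]) ∧
      ∀ w y : List Bool, (E (boolPair w y) = [true] ↔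
        MvPolynomial.aeval
          (ptOf p (kOf d w.length) (v.eval w.length) (modPoly p (bOf p d w.length) (kOf d w.length) y)
            (y.drop (kOf d w.length * bOf p d w.length)))
          (MvPolynomial.map (Int.castRingHom (ZMod p)) (rdCircuit (v.eval w.length) w).eval) = 0) := by
  obtain ⟨F, hF, hFs⟩ := acceptBit_codeFP (p := p) (v := v) (d := d)
  obtain ⟨T, hT, hTs⟩ := isTrue_codeFP
  refine ⟨T ∘ F, comp_mem_FP hT hF, fun z => ?_, fun w y => ?_⟩
  · have h := hTs (F z)
    simp only [Function.comp_apply]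
    rw [show T (F z) = bitE (decide (F z = [true])) from h]
    cases decide (F z = [true]) <;> simp [bitE]
  · have hFwy : F (boolPair w y) = bitE (acceptBit p v d (w, y)) := hFs (w, y)
    rw [← acceptBit_eq_true_iff, Function.comp_apply, show T (F (boolPair w y)) = bitE (decide (F (boolPair w y) = [true]))
      from hTs _, hFwy]
    cases acceptBit p v d (w, y) <;> simp [bitE]

end Machine

end ExtEval

end CircuitCode

end Literature.Computability.AlgebraicComplexity

end
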